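import Mathlib
import HarnessLib
import Summits.HubbardSuperconductivity.HubbardSuperconductivity.Theorems.KLProgrammeH10TwoPointLimitKlAnisoTightBundleBricks

/-!
# Route `KLProgramme` — K3 engine (stmt-HubbardSuperconductivity-20437), stub (b) (ℓ)/(I2), located item «ON-CLASS-KB»:
# the WIDE / NARROW dichotomy for coarse label tuples

Cell gate-hubbard-kl, seat p4 g13 (memo HOME/prover-p4/CLAIM-U-API.md §3b).  The WIDE on-class row (`…KlAnisoOnUmklappCountWide`) wants two non-pinned
legs `i₀, j₀` whose half-turned coarse centres have `pairAngle > Θ + 5w_k` (`pairAngle` = angle MOD π); the NARROW row (`…KlAnisoNarrowConeCount`) wants a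
sector `b` with every non-pinned half-turned index within `C′` of `b` modulo `2^k = N/2`.  This file proves that every tuple is one or the other, with
`C′ = ⌊Θ′/w_k⌋` for the threshold `Θ′`:

* `torusDist_add_pi_le` — `‖x + π‖_{𝕋¹} ≤ π − ‖x‖_{𝕋¹}`;
* `exists_coneOffset_of_pairAngle_le` — `pairAngle(centre_k a, centre_k a′) ≤ Θ′` ⇒ `∃ D ∈ ℤ`, `|D|·w_k ≤ Θ′`, `2^k ∣ (a′ − a − D)`;
* **`wide_or_narrowCone`** — for every `σ′`, `p`, `Θ′`: either `∃ i₀ ≠ p, j₀ ≠ p` with `Θ′ < pairAngle(centre_k(ht σ′ i₀), centre_k(ht σ′ j₀))`, or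
  `∃ b, ∀ i ≠ p, ∃ D, |D| ≤ ⌊Θ′/w_k⌋ ∧ 2^k ∣ (ht(σ′ i) − b − D)` (`ht` = the half-turned index, spelled out as in the counting rows).
PROVED; no definitions, no named facts; nothing here asserts anything about the model or superconductivity. [folklore]
-/

noncomputable section

namespace Summit.HubbardSuperconductivity.HubbardSuperconductivity.Theorems.PerturbedFermiCurve

set_option linter.dupNamespace false -- summit = problem name (single-conjunct summit), D-0017

open Classical
open Real Set Finset
open Literature.MathematicalPhysics.QuantumLattice Literature.MathematicalPhysics.QuantumLattice.BandSectorCounting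
open Literature.MathematicalPhysics.QuantumLattice.FermiRG Literature.MathematicalPhysics.QuantumLattice.FermiRG.BGM2003

/-! ## §1 Half-turn on the torus -/

/-- `‖x + π‖_{𝕋¹} ≤ π − ‖x‖_{𝕋¹}` (in fact equality). [folklore] -/
theorem torusDist_add_pi_le (x : ℝ) : FermiRG.torusDist (x + π) ≤ π - FermiRG.torusDist x := by
  obtain ⟨r, hr⟩ := exists_torusDist_eq_abs x
  have hle : |x + r * (2 * π)| ≤ π := by rw [← hr]; exact torusDist_le_pi_self x
  set y := x + r * (2 * π) with hy
  have e1 : x + π = (y + π) + (-r : ℤ) * (2 * π) := by rw [hy]; push_cast; ring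
  rw [e1, torusDist_add_int_mul_two_pi, hr]
  by_cases h0 : 0 ≤ y
  · have e2 : y + π = (y - π) + (1 : ℤ) * (2 * π) := by push_cast; ring
    rw [e2, torusDist_add_int_mul_two_pi, abs_of_nonneg h0]
    calc FermiRG.torusDist (y - π) ≤ |y - π| := torusDist_le_abs_self _
      _ = π - y := by
          rw [abs_of_nonpos (by linarith [(abs_le.1 hle).2])]; ring
  · push Not at h0
    rw [abs_of_neg h0]
    calc FermiRG.torusDist (y + π) ≤ |y + π| := torusDist_le_abs_self _
      _ = π - -y := by
          rw [abs_of_nonneg (by linarith [(abs_le.1 hle).1])]; ring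

/-! ## §2 From a small pair angle to a cone offset -/

/-- **Small pair angle ⇒ cone offset.**  If the centres of sectors `a, a′` (scale `k`) have `pairAngle ≤ Θ′` (angle mod `π`), then `a′ = a + D (mod 2^k)`
with an integer offset `|D|·w_k ≤ Θ′`. [folklore] -/
theorem exists_coneOffset_of_pairAngle_le {k a a' : ℕ} {Θ' : ℝ} (h : pairAngle (sectorCenter k a) (sectorCenter k a') ≤ Θ') :
    ∃ D : ℤ, |(D : ℝ)| * sectorWidth k ≤ Θ' ∧ ((2 : ℤ) ^ k) ∣ ((a' : ℤ) - a - D) := by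
  have hw := sectorWidth_pos k
  have hNw := sectorCount_mul_sectorWidth k
  have hN2 : (sectorCount k : ℝ) = 2 * 2 ^ k := by unfold sectorCount; push_cast; ring
  have hπk : (2 : ℝ) ^ k * sectorWidth k = π := by rw [hN2] at hNw; linarith
  have hx : sectorCenter k a - sectorCenter k a' = ((a : ℝ) - a') * sectorWidth k := by
    rw [BandSectorCounting.sectorCenter_eq, BandSectorCounting.sectorCenter_eq]; ring
  unfold pairAngle at h
  rw [hx] at h
  rcases min_le_iff.1 h with h1 | h1
  · obtain ⟨r, hr⟩ := exists_torusDist_eq_abs (((a : ℝ) - a') * sectorWidth k)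
    rw [hr] at h1
    refine ⟨(a' : ℤ) - a - 2 ^ k * (2 * r), ?_, ⟨2 * r, by ring⟩⟩
    have e : ((a : ℝ) - a') * sectorWidth k + r * (2 * π) = -((((a' : ℤ) - a - 2 ^ k * (2 * r) : ℤ) : ℝ) * sectorWidth k) := by
      push_cast; rw [← hπk]; ring
    rwa [e, abs_neg, abs_mul, abs_of_pos hw] at h1
  · have h2 : FermiRG.torusDist (((a : ℝ) - a') * sectorWidth k + π) ≤ Θ' := (torusDist_add_pi_le _).trans h1
    obtain ⟨r, hr⟩ := exists_torusDist_eq_abs (((a : ℝ) - a') * sectorWidth k + π)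
    rw [hr] at h2
    refine ⟨(a' : ℤ) - a - 2 ^ k * (2 * r + 1), ?_, ⟨2 * r + 1, by ring⟩⟩
    have e : ((a : ℝ) - a') * sectorWidth k + π + r * (2 * π) = -((((a' : ℤ) - a - 2 ^ k * (2 * r + 1) : ℤ) : ℝ) * sectorWidth k) := by
      push_cast; rw [← hπk]; ring
    rwa [e, abs_neg, abs_mul, abs_of_pos hw] at h2

/-! ## §3 The dichotomy -/

/-- **WIDE or NARROW.**  For a coarse label tuple `σ′` (scale `k`, `m + 1` legs), a pinned leg `p` and a threshold `Θ′` (for `Θ′ < 0` the first alternative or `m = 0` holds trivially): either two non-pinned legs have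
half-turned coarse centres with `pairAngle > Θ′` (the WIDE row's hypothesis), or all non-pinned half-turned indices lie within `⌊Θ′/w_k⌋` of one sector
modulo `2^k` (the NARROW row's cluster condition). [folklore] -/
theorem wide_or_narrowCone {k m : ℕ} (σ' : Fin (m + 1) → SectorLeg (sectorCount k)) (p : Fin (m + 1)) (Θ' : ℝ) :
    (∃ i₀ j₀ : Fin (m + 1), i₀ ≠ p ∧ j₀ ≠ p ∧ Θ' < pairAngle
        (sectorCenter k (if (σ' i₀).2 = 0 then ((σ' i₀).1.1 : ℕ) else
          if ((σ' i₀).1.1 : ℕ) < 2 ^ k then ((σ' i₀).1.1 : ℕ) + 2 ^ k else ((σ' i₀).1.1 : ℕ) - 2 ^ k))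
        (sectorCenter k (if (σ' j₀).2 = 0 then ((σ' j₀).1.1 : ℕ) else
          if ((σ' j₀).1.1 : ℕ) < 2 ^ k then ((σ' j₀).1.1 : ℕ) + 2 ^ k else ((σ' j₀).1.1 : ℕ) - 2 ^ k))) ∨
    (∃ b : Fin (sectorCount k), ∀ i, i ≠ p → ∃ D : ℤ, |D| ≤ (⌊Θ' / sectorWidth k⌋₊ : ℕ) ∧ ((2 : ℤ) ^ k) ∣
        ((((if (σ' i).2 = 0 then ((σ' i).1.1 : ℕ) else
            if ((σ' i).1.1 : ℕ) < 2 ^ k then ((σ' i).1.1 : ℕ) + 2 ^ k else ((σ' i).1.1 : ℕ) - 2 ^ k : ℕ) : ℤ)) - b - D)) := by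
  have hw := sectorWidth_pos k
  have hN := sectorCount_pos k
  set ht : SectorLeg (sectorCount k) → ℕ := fun x =>
    if x.2 = 0 then (x.1.1 : ℕ) else if (x.1.1 : ℕ) < 2 ^ k then (x.1.1 : ℕ) + 2 ^ k else (x.1.1 : ℕ) - 2 ^ k with hht
  have ht_lt : ∀ x : SectorLeg (sectorCount k), ht x < sectorCount k := by
    intro x; simp only [hht]
    by_cases h0 : x.2 = 0
    · rw [if_pos h0]; exact x.1.1.isLt
    · rw [if_neg h0]; exact halfTurnIdx_lt false x.1.1.isLt
  by_cases hwide : ∃ i₀ j₀ : Fin (m + 1), i₀ ≠ p ∧ j₀ ≠ p ∧ Θ' < pairAngle (sectorCenter k (ht (σ' i₀))) (sectorCenter k (ht (σ' j₀)))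
  · exact Or.inl hwide
  right
  push Not at hwide
  by_cases hex : ∃ i₁ : Fin (m + 1), i₁ ≠ p
  · obtain ⟨i₁, hi₁⟩ := hex
    refine ⟨⟨ht (σ' i₁), ht_lt _⟩, fun i hi => ?_⟩
    have hpa : pairAngle (sectorCenter k (ht (σ' i₁))) (sectorCenter k (ht (σ' i))) ≤ Θ' := hwide i₁ i hi₁ hi
    obtain ⟨D, hD, hdvd⟩ := exists_coneOffset_of_pairAngle_le hpa
    refine ⟨D, ?_, hdvd⟩
    have h2 : |(D : ℝ)| ≤ Θ' / sectorWidth k := by rw [le_div_iff₀ hw]; exact hD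
    have h3 : |(D : ℝ)| < (⌊Θ' / sectorWidth k⌋₊ : ℕ) + 1 := h2.trans_lt (Nat.lt_floor_add_one _)
    have h5 : ((|D| : ℤ) : ℝ) < ((⌊Θ' / sectorWidth k⌋₊ : ℕ) : ℝ) + 1 := by rw [Int.cast_abs]; exact h3
    have h6 : (|D| : ℤ) < ((⌊Θ' / sectorWidth k⌋₊ : ℕ) : ℤ) + 1 := by exact_mod_cast h5
    omega
  · push Not at hex
    exact ⟨⟨0, hN⟩, fun i hi => absurd (hex i) hi⟩

end Summit.HubbardSuperconductivity.HubbardSuperconductivity.Theorems.PerturbedFermiCurve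

end
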